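import Summits.QuantumFields.BalabanUV.Beta.GAN24.OneStepConstraintRate
import Summits.QuantumFields.BalabanUV.T4Continuum.Support.DecayRateInterpolation

/-!
# `BalabanUV.Beta.GAN24.OneStepConstraintModelLetters` — binder row G-an2-4 ∕ (CONV-C), routes C-R6° («VALUES») × R7 («TWO CURRENCIES»), PART 173:
# THE MODEL-SIDE LETTERS OF PARTs 170 ∕ 172 IN THE LINEAGE's `ℂ`-TYPED CURRENCY — for an `IsReal` matrix `A` (the lineage's letters are real, PART 167) the fine form `H = re A`
# of PART 170 is symmetric when `A` is Hermitian, its quadratic form is `re⟨v, Av⟩` on complexified vectors, so: `CoerciveInverseTower.Coercive 0 A` ⟹ `H` PSD, the `ℓ²`-operator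
# norm gives `⟨u,Hu⟩ ≤ ‖A‖·|u|²`, a `ℂ`-kernel coercivity of `A` on `ker QB` gives PART 169's `hker`, and `DecayRateInterpolation.EntryDecay` (the (UD) ∕ (SR) shapes of the INPUT triple)
# gives PART 170's `hHent` and PART 172's `hdiff`; hence the one-loop letter's DECAY and STEP-RATE ENDs with every hypothesis in the currency of PARTs 115–163
# (unit b2b-balaban-gan24-p3, gen 58; v1)

NOT IN PRINT; OUR PROOF ([folklore] bookkeeping BY NAME: b05's `B5RealFields` (`reM`, `cplx`, `IsReal.cplx_mulVec`, `star_cplx_dotProduct`, `nsq_cplx`, `cplx_eq_zero_iff`,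
`reM_transpose_of_isHermitian`, `reM_sub`), `B5Prop11Lower` (`nsq`, `norm_star_dotProduct_le`, `nsq_mulVec_le`), the NE2 lineage's `CoerciveInverseTower.Coercive` and
`DecayRateInterpolation.EntryDecay`, PART 167 `isReal_QB`, PART 170 `abs_flucCov_le_QB`, PART 172 `abs_flucCov_sub_le_QB`.  Nothing printed is a hypothesis.)
HONEST FRAMING (cell contract, verbatim): «discharging `BetaPertH` makes Bałaban's UV stability UNCONDITIONAL — a real constructive-QFT result; it is NOT the continuum limit
and NOT the Clay problem.»  HONEST DEPENDENCY (verbatim): «continuum YM on T⁴ ⇐ BetaPertH ∧ nine spine estimates (0/9 proved); BetaPertH ⇐ (D1) ∧ (D4) ∧ CAP+tail; G-an2-4 gates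
asym, D1 and NE2/3/4.»

WHY.  PARTs 170 ∕ 172 are stated over `ℝ` (PART 105 ∕ 106's currency: `Hᵀ = H`, `0 ≤ ⟨u,Hu⟩ ≤ h|u|²`, `γ₀` on `ker (re QB)`, `|H(x,x′)| ≤ h₀e^{−δ_H·D}`, `|(H − H′)(x,x′)| ≤ εe^{−δ_H·D}`); the lineage's
effective forms `Σ_k` and their INPUT triple are `ℂ`-typed (`IsReal`, Hermitian, `Coercive γ`, `EntryDecay distK`, `TwoLevelDecayRate`).  THIS FILE is the dictionary between the two, so that
the V195 adapter only has to produce the `ℂ`-typed letters of the block-lattice image of `Σ_k` (and the one genuinely new input: a `k`-uniform coercivity on `ker QB`, (2.153)-type).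

WHAT THIS FILE PROVES (0 sorry, 0 `def`; `ν` any finite index; then `N, R ≥ 1`, every torus `M`, every `d`):
* §1 (generic, `A : Matrix ν ν ℂ` with `IsReal A`): `dotProduct_reM_mulVec` (`⟨z, (re A)z⟩ = re⟨ẑ, Aẑ⟩`, `ẑ = cplx z`), `dotProduct_self_eq_nsq` (`|z|² = nsq ẑ`), **`psd_reM_of_coercive`**
  (`Coercive γ A`, `0 ≤ γ` ⟹ `0 ≤ ⟨z,(re A)z⟩`), **`coercive_reM_of_coercive`** (`γ|z|² ≤ ⟨z,(re A)z⟩`), **`form_reM_le_opNorm`** (`⟨z,(re A)z⟩ ≤ ‖A‖·|z|²`),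
  **`abs_reM_le_of_entryDecay`** (`EntryDecay dist A B δ ⟹ |re A(x,y)| ≤ Be^{−δ·dist}`), **`abs_reM_sub_le_of_entryDecay`** (the same for `A − A′`, i.e. PART 172's `hdiff`).
* §2 (Bałaban's one-step constraint): **`ker_coercive_reM_QB`** — a `ℂ`-kernel coercivity `QB·v = 0 ⟹ γ₀·nsq v ≤ re⟨v,Av⟩` gives PART 169 ∕ 170's `hker` for `re QB`, `re A`.
* §3 IN THE `ℂ` CURRENCY: `abs_effForm_le_QB_of_complexLetters`, `abs_minOp_le_QB_of_complexLetters`, and THE ONE-LOOP LETTER **`abs_flucCov_le_QB_of_complexLetters`** (PART 170 `abs_flucCov_le_QB` for `H = re A`: `A` real Hermitian, `Coercive 0 A`, kernel-coercive on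
  `ker QB`, `EntryDecay D A h₀ δ_H`, `h = ‖A‖`) and **`abs_flucCov_sub_le_QB_of_complexLetters`** (PART 172 `abs_flucCov_sub_le_QB` for `H = re A`, `H′ = re A′` with the (SR) letter
  `EntryDecay D (A − A′) ε δ_H`).
WHAT IT IS NOT: no letter of the lineage's `Σ_k` is discharged here (that is the V195 adapter proper, after V197); the STEP-RATE versions for `𝒮`, `ℋ` are the same two lines against
PART 172 and are left to the consumer.  SUPPLIER work; NEVER «G-an2-4 closed»; NOT (CONV-C), NOT D1, NOT `BetaPertH`, NOT continuum, NOT Clay.  Records: `HOME/b2b-balaban-gan24-p3/gen58/README.md`.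
-/

noncomputable section

open scoped BigOperators Matrix Matrix.Norms.L2Operator
open Finset Matrix

namespace Summit.QuantumFields.BalabanUV.Beta.GAN24.OneStepConstraintModelLetters

open Literature.MathematicalPhysics.QuantumFieldTheory.Balaban1983to89
open Literature.MathematicalPhysics.QuantumFieldTheory.Balaban1983to89.B4Sect5Torus (rate)
open Literature.MathematicalPhysics.QuantumFieldTheory.Balaban1983to89.Beta.CompositionSingular (effForm minOp flucCov)
open Literature.MathematicalPhysics.QuantumFieldTheory.Balaban1983to89.B5Prop11Plancherel (Tor fine)
open Literature.MathematicalPhysics.QuantumFieldTheory.Balaban1983to89.B5Prop11Lower (nsq nsq_nonneg norm_star_dotProduct_le nsq_mulVec_le)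
open Literature.MathematicalPhysics.QuantumFieldTheory.Balaban1983to89.B5RealFields (IsReal reM cplx reM_apply cplx_apply star_cplx_dotProduct nsq_cplx cplx_eq_zero_iff
  reM_transpose_of_isHermitian reM_sub)
open Literature.MathematicalPhysics.QuantumFieldTheory.Balaban1983to89.Beta.VectorTailsCov (tdist)
open Summit.QuantumFields.BalabanUV.T4Continuum.BalabanLineAverage (QB)
open Summit.QuantumFields.BalabanUV.T4Continuum.BalabanAveragedTowerModes (par)
open Summit.QuantumFields.BalabanUV.T4Continuum.CoerciveInverseTower (Coercive)
open Summit.QuantumFields.BalabanUV.T4Continuum.DecayRateInterpolation (EntryDecay)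
open Summit.QuantumFields.BalabanUV.Beta.GAN24.FirstOrderModelRealLetters (isReal_QB)
open Summit.QuantumFields.BalabanUV.Beta.GAN24.OneStepConstraintLocalisation (abs_effForm_le_QB abs_minOp_le_QB abs_flucCov_le_QB)
open Summit.QuantumFields.BalabanUV.Beta.GAN24.OneStepConstraintRate (abs_flucCov_sub_le_QB)

/-! ## §1 Real readings of `ℂ`-typed letters -/

section Generic

variable {ν : Type*} [Fintype ν] [DecidableEq ν]

omit [DecidableEq ν] in
/-- `|z|² = nsq ẑ` for the complexification `ẑ = cplx z` of a real vector. [folklore] -/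
theorem dotProduct_self_eq_nsq (z : ν → ℝ) : z ⬝ᵥ z = nsq (cplx z) := by
  rw [nsq_cplx, dotProduct]
  exact Finset.sum_congr rfl fun i _ => by ring

omit [DecidableEq ν] in
/-- **the real quadratic form of `re A` is the real part of the complex one**: `⟨z, (re A)z⟩ = re⟨ẑ, Aẑ⟩` for a real matrix `A`. [folklore] -/
theorem dotProduct_reM_mulVec {A : Matrix ν ν ℂ} (hA : IsReal A) (z : ν → ℝ) :
    z ⬝ᵥ (reM A *ᵥ z) = (star (cplx z) ⬝ᵥ (A *ᵥ cplx z)).re := by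
  rw [← hA.cplx_mulVec, star_cplx_dotProduct, Complex.ofReal_re]

omit [DecidableEq ν] in
/-- **`Coercive γ A` with `γ ≥ 0` ⟹ `re A` has nonnegative form** (PART 170's `hpsd`). [folklore] -/
theorem psd_reM_of_coercive {A : Matrix ν ν ℂ} (hA : IsReal A) {γ : ℝ} (hγ : 0 ≤ γ) (hco : Coercive γ A) (z : ν → ℝ) : 0 ≤ z ⬝ᵥ (reM A *ᵥ z) := by
  rw [dotProduct_reM_mulVec hA]
  exact (mul_nonneg hγ (nsq_nonneg _)).trans (hco (cplx z))

omit [DecidableEq ν] in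
/-- **`Coercive γ A` ⟹ `re A` is `γ`-coercive on real vectors**: `γ|z|² ≤ ⟨z,(re A)z⟩`. [folklore] -/
theorem coercive_reM_of_coercive {A : Matrix ν ν ℂ} (hA : IsReal A) {γ : ℝ} (hco : Coercive γ A) (z : ν → ℝ) : γ * (z ⬝ᵥ z) ≤ z ⬝ᵥ (reM A *ᵥ z) := by
  rw [dotProduct_reM_mulVec hA, dotProduct_self_eq_nsq]
  exact hco (cplx z)

/-- **the upper form bound from the `ℓ²`-operator norm** (PART 170's `hHub` with `h = ‖A‖`): `⟨z,(re A)z⟩ ≤ ‖A‖·|z|²`. [folklore] -/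
theorem form_reM_le_opNorm {A : Matrix ν ν ℂ} (hA : IsReal A) (z : ν → ℝ) : z ⬝ᵥ (reM A *ᵥ z) ≤ ‖A‖ * (z ⬝ᵥ z) := by
  rw [dotProduct_reM_mulVec hA, dotProduct_self_eq_nsq]
  have h1 := (Complex.re_le_norm _).trans (norm_star_dotProduct_le (cplx z) (A *ᵥ cplx z))
  have h2 : Real.sqrt (nsq (A *ᵥ cplx z)) ≤ ‖A‖ * Real.sqrt (nsq (cplx z)) := by
    rw [← Real.sqrt_sq (norm_nonneg A), ← Real.sqrt_mul (sq_nonneg _)]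
    exact Real.sqrt_le_sqrt (nsq_mulVec_le A (cplx z))
  have h0 : 0 ≤ Real.sqrt (nsq (cplx z)) := Real.sqrt_nonneg _
  calc (star (cplx z) ⬝ᵥ (A *ᵥ cplx z)).re ≤ Real.sqrt (nsq (cplx z)) * Real.sqrt (nsq (A *ᵥ cplx z)) := h1
    _ ≤ Real.sqrt (nsq (cplx z)) * (‖A‖ * Real.sqrt (nsq (cplx z))) := mul_le_mul_of_nonneg_left h2 h0
    _ = ‖A‖ * (Real.sqrt (nsq (cplx z)) * Real.sqrt (nsq (cplx z))) := by ring
    _ = ‖A‖ * nsq (cplx z) := by rw [Real.mul_self_sqrt (nsq_nonneg _)]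

omit [Fintype ν] [DecidableEq ν] in
/-- **`EntryDecay` ⟹ PART 170's entry letter for `re A`**: `|re A(x,y)| ≤ B·e^{−δ·dist(x,y)}`. [folklore] -/
theorem abs_reM_le_of_entryDecay {dist : ν → ν → ℝ} {A : Matrix ν ν ℂ} {B δ : ℝ} (hA : EntryDecay dist A B δ) (x y : ν) :
    |reM A x y| ≤ B * Real.exp (-(δ * dist x y)) :=
  (Complex.abs_re_le_norm _).trans (hA x y)

omit [Fintype ν] [DecidableEq ν] in
/-- **`EntryDecay` of a difference ⟹ PART 172's rate letter for `re A − re A′`**. [folklore] -/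
theorem abs_reM_sub_le_of_entryDecay {dist : ν → ν → ℝ} {A A' : Matrix ν ν ℂ} {ε δ : ℝ} (hA : EntryDecay dist (A - A') ε δ) (x y : ν) :
    |(reM A - reM A') x y| ≤ ε * Real.exp (-(δ * dist x y)) := by
  rw [← reM_sub]
  exact abs_reM_le_of_entryDecay hA x y

end Generic

/-! ## §2 The kernel coercivity on `ker QB` in the `ℂ` currency -/

section Kernel

variable {d : ℕ} (N R : ℕ) [NeZero N] [NeZero R] (M : Fin d → ℕ) [hM : ∀ μ, NeZero (M μ)]

/-- **`ker_coercive_reM_QB`** — PART 169 ∕ 170's `hker` from a `ℂ`-kernel coercivity: if `QB·v = 0 ⟹ γ₀·nsq v ≤ re⟨v, Av⟩` for complex `v`, then for real `z` with `(re QB)z = 0`,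
`γ₀|z|² ≤ ⟨z, (re A)z⟩` (`QB` is real, PART 167, so `(re QB)z = 0 ⟺ QB·ẑ = 0`). [folklore] -/
theorem ker_coercive_reM_QB {A : Matrix (Tor (fine (R * N) M) × Fin d) (Tor (fine (R * N) M) × Fin d) ℂ} (hA : IsReal A) {γ₀ : ℝ}
    (hkerC : ∀ v : Tor (fine (R * N) M) × Fin d → ℂ, QB N R M *ᵥ v = 0 → γ₀ * nsq v ≤ (star v ⬝ᵥ (A *ᵥ v)).re)
    (z : Tor (fine (R * N) M) × Fin d → ℝ) (hz : reM (QB N R M) *ᵥ z = 0) : γ₀ * (z ⬝ᵥ z) ≤ z ⬝ᵥ (reM A *ᵥ z) := by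
  rw [dotProduct_reM_mulVec hA, dotProduct_self_eq_nsq]
  refine hkerC (cplx z) ?_
  rw [← (isReal_QB N R M).cplx_mulVec, hz]
  exact (cplx_eq_zero_iff _).mpr rfl

end Kernel

/-! ## §3 The one-loop letter's decay and step rate with every hypothesis in the `ℂ` currency -/

section Ends

variable {d : ℕ} (N R : ℕ) [NeZero N] [NeZero R] (M : Fin d → ℕ) [hM : ∀ μ, NeZero (M μ)]
variable {A A' : Matrix (Tor (fine (R * N) M) × Fin d) (Tor (fine (R * N) M) × Fin d) ℂ} {Kf : ℝ → ℝ}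

/-- **`abs_effForm_le_QB_of_complexLetters`** — PART 170 `abs_effForm_le_QB` for `H = re A` with `ℂ`-typed letters (`h = ‖A‖`): `|𝒮(b,b′)| ≤ (2(Λ+a)+a)·e^{−r_U·tdist(b,b′)}`. [folklore] -/
theorem abs_effForm_le_QB_of_complexLetters (hKf0 : ∀ s : ℝ, 0 < s → 0 ≤ Kf s)
    (hKf : ∀ s : ℝ, 0 < s → ∀ y : Tor (fine N M), ∑ y' : Tor (fine N M), Real.exp (-(s * (tdist y y' : ℝ))) ≤ Kf s)
    (hAr : IsReal A) (hAh : A.IsHermitian) (hpsdC : Coercive 0 A) {γ₀ : ℝ} (hγ₀ : 0 < γ₀)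
    (hkerC : ∀ v : Tor (fine (R * N) M) × Fin d → ℂ, QB N R M *ᵥ v = 0 → γ₀ * nsq v ≤ (star v ⬝ᵥ (A *ᵥ v)).re)
    {a h₀ δH : ℝ} (ha : 0 < a) (hh₀ : 0 ≤ h₀) (hδH : 0 < δH)
    (hdec : EntryDecay (fun x x' : Tor (fine (R * N) M) × Fin d => (tdist (par N R M x.1) (par N R M x'.1) : ℝ)) A h₀ δH)
    {γK cK rF c₀ Λ rU : ℝ} (hγK : γK = (max (4 / γ₀) ((4 * ‖A‖ * ((R : ℝ) ^ d) ^ 2 / γ₀ + 2 * ((R : ℝ) ^ d) ^ 2) / a))⁻¹)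
    (hcK : cK = h₀ + a * (((R : ℝ) ^ d)⁻¹ * ((R : ℝ) ^ d)⁻¹) * Real.exp (2 * δH)) (hrF : rF = rate (fun s => (d : ℝ) * (R : ℝ) ^ d * Kf s) γK cK δH)
    (hc₀ : c₀ = 2 / γK * Real.exp (2 * rF)) (hΛ : Λ = ‖A‖ * ((R : ℝ) ^ d) ^ 2) (hrU : rU = rate (fun s => (d : ℝ) * Kf s) (Λ + a)⁻¹ c₀ rF)
    (b b' : Tor (fine N M) × Fin d) :
    |effForm (reM A) (reM (QB N R M)) b b'| ≤ (2 * (Λ + a) + a) * Real.exp (-(rU * (tdist b.1 b'.1 : ℝ))) :=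
  abs_effForm_le_QB N R M hKf0 hKf (reM_transpose_of_isHermitian hAh) (psd_reM_of_coercive hAr le_rfl hpsdC) (norm_nonneg A) (form_reM_le_opNorm hAr) hγ₀
    (ker_coercive_reM_QB N R M hAr hkerC) ha hh₀ hδH (abs_reM_le_of_entryDecay hdec) hγK hcK hrF hc₀ hΛ hrU b b'

/-- **`abs_minOp_le_QB_of_complexLetters`** — PART 170 `abs_minOp_le_QB` for `H = re A` with `ℂ`-typed letters: `|ℋ(x,b)| ≤ 2(Λ+a)·c₁·(d·Kf(m∕2))·e^{−(m∕2)·tdist(par x, b)}`. [folklore] -/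
theorem abs_minOp_le_QB_of_complexLetters (hKf0 : ∀ s : ℝ, 0 < s → 0 ≤ Kf s)
    (hKf : ∀ s : ℝ, 0 < s → ∀ y : Tor (fine N M), ∑ y' : Tor (fine N M), Real.exp (-(s * (tdist y y' : ℝ))) ≤ Kf s)
    (hAr : IsReal A) (hAh : A.IsHermitian) (hpsdC : Coercive 0 A) {γ₀ : ℝ} (hγ₀ : 0 < γ₀)
    (hkerC : ∀ v : Tor (fine (R * N) M) × Fin d → ℂ, QB N R M *ᵥ v = 0 → γ₀ * nsq v ≤ (star v ⬝ᵥ (A *ᵥ v)).re)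
    {a h₀ δH : ℝ} (ha : 0 < a) (hh₀ : 0 ≤ h₀) (hδH : 0 < δH)
    (hdec : EntryDecay (fun x x' : Tor (fine (R * N) M) × Fin d => (tdist (par N R M x.1) (par N R M x'.1) : ℝ)) A h₀ δH)
    {γK cK rF c₀ c₁ Λ rU m : ℝ} (hγK : γK = (max (4 / γ₀) ((4 * ‖A‖ * ((R : ℝ) ^ d) ^ 2 / γ₀ + 2 * ((R : ℝ) ^ d) ^ 2) / a))⁻¹)
    (hcK : cK = h₀ + a * (((R : ℝ) ^ d)⁻¹ * ((R : ℝ) ^ d)⁻¹) * Real.exp (2 * δH)) (hrF : rF = rate (fun s => (d : ℝ) * (R : ℝ) ^ d * Kf s) γK cK δH)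
    (hc₀ : c₀ = 2 / γK * Real.exp (2 * rF)) (hc₁ : c₁ = 2 / γK * Real.exp rF) (hΛ : Λ = ‖A‖ * ((R : ℝ) ^ d) ^ 2)
    (hrU : rU = rate (fun s => (d : ℝ) * Kf s) (Λ + a)⁻¹ c₀ rF) (hm : m = min rF rU)
    (x : Tor (fine (R * N) M) × Fin d) (b : Tor (fine N M) × Fin d) :
    |minOp (reM A) (reM (QB N R M)) x b| ≤ 2 * (Λ + a) * c₁ * ((d : ℝ) * Kf (m / 2)) * Real.exp (-(m / 2 * (tdist (par N R M x.1) b.1 : ℝ))) :=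
  abs_minOp_le_QB N R M hKf0 hKf (reM_transpose_of_isHermitian hAh) (psd_reM_of_coercive hAr le_rfl hpsdC) (norm_nonneg A) (form_reM_le_opNorm hAr) hγ₀
    (ker_coercive_reM_QB N R M hAr hkerC) ha hh₀ hδH (abs_reM_le_of_entryDecay hdec) hγK hcK hrF hc₀ hc₁ hΛ hrU hm x b

/-- **`abs_flucCov_le_QB_of_complexLetters` — THE ONE-LOOP LETTER's DECAY (UD) FROM `ℂ`-TYPED LETTERS** [our proof; PART 170 `abs_flucCov_le_QB` with §1–§2]: `A` real Hermitian with
`Coercive 0 A` (nonnegative form), kernel-coercive on `ker QB` (`γ₀ > 0`), `EntryDecay (tdist ∘ par) A h₀ δ_H`, `a > 0`, site profile `Kf` ⟹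
`|flucCov (re A) (re QB) (x,x′)| ≤ (2∕γ_K + 2(Λ+a)c₁²(d·Kf(m∕2))(d·Kf(m∕4)))·e^{−min r_F (m∕4)·tdist(par x, par x′)}` with PART 170's constants at `h = ‖A‖`. -/
theorem abs_flucCov_le_QB_of_complexLetters (hKf0 : ∀ s : ℝ, 0 < s → 0 ≤ Kf s)
    (hKf : ∀ s : ℝ, 0 < s → ∀ y : Tor (fine N M), ∑ y' : Tor (fine N M), Real.exp (-(s * (tdist y y' : ℝ))) ≤ Kf s)
    (hAr : IsReal A) (hAh : A.IsHermitian) (hpsdC : Coercive 0 A) {γ₀ : ℝ} (hγ₀ : 0 < γ₀)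
    (hkerC : ∀ v : Tor (fine (R * N) M) × Fin d → ℂ, QB N R M *ᵥ v = 0 → γ₀ * nsq v ≤ (star v ⬝ᵥ (A *ᵥ v)).re)
    {a h₀ δH : ℝ} (ha : 0 < a) (hh₀ : 0 ≤ h₀) (hδH : 0 < δH)
    (hdec : EntryDecay (fun x x' : Tor (fine (R * N) M) × Fin d => (tdist (par N R M x.1) (par N R M x'.1) : ℝ)) A h₀ δH)
    {γK cK rF c₀ c₁ Λ rU m : ℝ} (hγK : γK = (max (4 / γ₀) ((4 * ‖A‖ * ((R : ℝ) ^ d) ^ 2 / γ₀ + 2 * ((R : ℝ) ^ d) ^ 2) / a))⁻¹)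
    (hcK : cK = h₀ + a * (((R : ℝ) ^ d)⁻¹ * ((R : ℝ) ^ d)⁻¹) * Real.exp (2 * δH)) (hrF : rF = rate (fun s => (d : ℝ) * (R : ℝ) ^ d * Kf s) γK cK δH)
    (hc₀ : c₀ = 2 / γK * Real.exp (2 * rF)) (hc₁ : c₁ = 2 / γK * Real.exp rF) (hΛ : Λ = ‖A‖ * ((R : ℝ) ^ d) ^ 2)
    (hrU : rU = rate (fun s => (d : ℝ) * Kf s) (Λ + a)⁻¹ c₀ rF) (hm : m = min rF rU)
    (x x' : Tor (fine (R * N) M) × Fin d) :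
    |flucCov (reM A) (reM (QB N R M)) x x'| ≤ (2 / γK + 2 * (Λ + a) * c₁ ^ 2 * ((d : ℝ) * Kf (m / 2)) * ((d : ℝ) * Kf (m / 4))) *
      Real.exp (-(min rF (m / 4) * (tdist (par N R M x.1) (par N R M x'.1) : ℝ))) :=
  abs_flucCov_le_QB N R M hKf0 hKf (reM_transpose_of_isHermitian hAh) (psd_reM_of_coercive hAr le_rfl hpsdC) (norm_nonneg A) (form_reM_le_opNorm hAr) hγ₀
    (ker_coercive_reM_QB N R M hAr hkerC) ha hh₀ hδH (abs_reM_le_of_entryDecay hdec) hγK hcK hrF hc₀ hc₁ hΛ hrU hm x x'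

/-- **`abs_flucCov_sub_le_QB_of_complexLetters` — THE ONE-LOOP LETTER's STEP RATE (SR) FROM `ℂ`-TYPED LETTERS** [our proof; PART 172 `abs_flucCov_sub_le_QB` with §1–§2]: two real
Hermitian `A, A′` with `Coercive 0`, `‖A‖, ‖A′‖ ≤ h`, the same kernel coercivity on `ker QB` and entry decay, and the (SR) letter `EntryDecay (tdist ∘ par) (A − A′) ε δ_H` ⟹
`|(flucCov (re A′) (re QB) − flucCov (re A) (re QB))(x,x′)| ≤ (PART 172's constant, every term with a factor ε)·e^{−(m′∕4)·tdist(par x, par x′)}`. -/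
theorem abs_flucCov_sub_le_QB_of_complexLetters (hKf0 : ∀ s : ℝ, 0 < s → 0 ≤ Kf s)
    (hKf : ∀ s : ℝ, 0 < s → ∀ y : Tor (fine N M), ∑ y' : Tor (fine N M), Real.exp (-(s * (tdist y y' : ℝ))) ≤ Kf s)
    (hAr : IsReal A) (hAh : A.IsHermitian) (hpsdC : Coercive 0 A) (hA'r : IsReal A') (hA'h : A'.IsHermitian) (hpsdC' : Coercive 0 A')
    {h : ℝ} (hAn : ‖A‖ ≤ h) (hA'n : ‖A'‖ ≤ h) {γ₀ : ℝ} (hγ₀ : 0 < γ₀)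
    (hkerC : ∀ v : Tor (fine (R * N) M) × Fin d → ℂ, QB N R M *ᵥ v = 0 → γ₀ * nsq v ≤ (star v ⬝ᵥ (A *ᵥ v)).re)
    (hkerC' : ∀ v : Tor (fine (R * N) M) × Fin d → ℂ, QB N R M *ᵥ v = 0 → γ₀ * nsq v ≤ (star v ⬝ᵥ (A' *ᵥ v)).re)
    {a h₀ δH : ℝ} (ha : 0 < a) (hh₀ : 0 ≤ h₀) (hδH : 0 < δH)
    (hdec : EntryDecay (fun x x' : Tor (fine (R * N) M) × Fin d => (tdist (par N R M x.1) (par N R M x'.1) : ℝ)) A h₀ δH)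
    (hdec' : EntryDecay (fun x x' : Tor (fine (R * N) M) × Fin d => (tdist (par N R M x.1) (par N R M x'.1) : ℝ)) A' h₀ δH) {ε : ℝ} (hε : 0 ≤ ε)
    (hstep : EntryDecay (fun x x' : Tor (fine (R * N) M) × Fin d => (tdist (par N R M x.1) (par N R M x'.1) : ℝ)) (A - A') ε δH)
    {γK cK rF r c₀ c₁ Λ εE rU' : ℝ} (hγK : γK = (max (4 / γ₀) ((4 * h * ((R : ℝ) ^ d) ^ 2 / γ₀ + 2 * ((R : ℝ) ^ d) ^ 2) / a))⁻¹)
    (hcK : cK = h₀ + a * (((R : ℝ) ^ d)⁻¹ * ((R : ℝ) ^ d)⁻¹) * Real.exp (2 * δH)) (hrF : rF = rate (fun s => (d : ℝ) * (R : ℝ) ^ d * Kf s) γK cK δH)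
    (hr : r = rF / 2) (hc₀ : c₀ = 2 / γK * Real.exp (2 * rF)) (hc₁ : c₁ = 2 / γK * Real.exp rF) (hΛ : Λ = h * ((R : ℝ) ^ d) ^ 2)
    (hεE : εE = (2 / γK) ^ 2 * ε * ((d : ℝ) * (R : ℝ) ^ d * Kf (rF / 2)) ^ 2) (hrU' : rU' = rate (fun s => (d : ℝ) * Kf s) (Λ + a)⁻¹ c₀ r)
    (x x' : Tor (fine (R * N) M) × Fin d) :
    |(flucCov (reM A') (reM (QB N R M)) - flucCov (reM A) (reM (QB N R M))) x x'| ≤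
      (εE + ((2 * (Λ + a) * ((1 : ℝ) * εE * Real.exp (r * 1)) +
              4 * (Λ + a) ^ 2 * ((d : ℝ) * Kf (rU' / 2)) ^ 2 * c₁ * ((1 : ℝ) ^ 2 * εE * Real.exp (r * 2))) *
            ((d : ℝ) * Kf (min r (rU' / 2) / 2)) * (c₁ + (1 : ℝ) * εE * Real.exp (r * 1)) +
          2 * (Λ + a) * c₁ * ((d : ℝ) * Kf (min r rU' / 2)) * ((1 : ℝ) * εE * Real.exp (r * 1))) *
        ((d : ℝ) * Kf (min r (rU' / 2) / 4))) *
        Real.exp (-(min r (rU' / 2) / 4 * (tdist (par N R M x.1) (par N R M x'.1) : ℝ))) := by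
  have hh : 0 ≤ h := (norm_nonneg A).trans hAn
  have hHub : ∀ u : Tor (fine (R * N) M) × Fin d → ℝ, u ⬝ᵥ (reM A *ᵥ u) ≤ h * (u ⬝ᵥ u) := fun u =>
    (form_reM_le_opNorm hAr u).trans (mul_le_mul_of_nonneg_right hAn (by rw [dotProduct]; exact Finset.sum_nonneg fun i _ => mul_self_nonneg _))
  have hHub' : ∀ u : Tor (fine (R * N) M) × Fin d → ℝ, u ⬝ᵥ (reM A' *ᵥ u) ≤ h * (u ⬝ᵥ u) := fun u =>
    (form_reM_le_opNorm hA'r u).trans (mul_le_mul_of_nonneg_right hA'n (by rw [dotProduct]; exact Finset.sum_nonneg fun i _ => mul_self_nonneg _))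
  exact abs_flucCov_sub_le_QB N R M hKf0 hKf (reM_transpose_of_isHermitian hAh) (psd_reM_of_coercive hAr le_rfl hpsdC) (reM_transpose_of_isHermitian hA'h)
    (psd_reM_of_coercive hA'r le_rfl hpsdC') hh hHub hHub' hγ₀ (ker_coercive_reM_QB N R M hAr hkerC) (ker_coercive_reM_QB N R M hA'r hkerC') ha hh₀ hδH
    (abs_reM_le_of_entryDecay hdec) (abs_reM_le_of_entryDecay hdec') hε (abs_reM_sub_le_of_entryDecay hstep) hγK hcK hrF hr hc₀ hc₁ hΛ hεE hrU' x x'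

end Ends

end Summit.QuantumFields.BalabanUV.Beta.GAN24.OneStepConstraintModelLetters

end
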